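/-
Copyright (c) 2026 the pub-hodgecm-mathlib formalisation cell (harness21).  Prover seat hodgecm-mathlib-F0P2-p01 (g15): road «S3-ram» (LEAD F0P3a-plan (g12); architect
A-p16 (g31) 22:45:35Z deal (a1) «SHELL RECURSION over the fixed-child criterion»; owner F0P3a-p06 (g15)), organ A′ (ii) «the per-vertex FIXED-CHILD COUNT»; 2026-09-01.
-/
import Literature.NumberTheory.Automorphic.UnitaryLatticeTreeFixedCostarDeep            -- ★ p847060 (F0P3a-p01 (g16)): the fixed-child CRITERION `mapGL_N₁_sup_span_vec_eq_iff_of_congr`, conjugation bookkeeping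
import Literature.NumberTheory.Automorphic.UnitaryLatticeTreeTypeTwoStarCountRamified    -- ★ R3 (B-p14): `mem_neighborSet_N₁_iff_exists_vec_of_neg`, `ncard_neighborSet_N₁_of_neg` (`#star(N₁) = q + 1`)
import Literature.NumberTheory.Automorphic.UnitaryLatticeTreeRootStarCountOfInvolution   -- ★ R2b: `ncard_neighborSet_root_of_ramified` (`#star(L₀) = q + 1`)
import Literature.NumberTheory.Automorphic.UnitaryLatticeTreeRootStarOrbitOfInvolution   -- ★ `mem_neighborSet_root_iff_exists_mem_unitaryInt_of_trace` (star of `L₀` = `{κ·N₁}`)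
import Literature.NumberTheory.Automorphic.UnitaryLatticeTreeApartment                   -- ★ `mapGL_stdLattice_of_mem_unitaryInt` (`K₀` fixes `L₀`)
import HarnessLib

/-!
# The lattice graph of a hermitian space — THE FIXED-CHILD COUNT AT A TAMELY RAMIFIED PLACE: a deep element of a vertex stabiliser fixes `0`, `q` or all `q` of the children
# through each modular neighbour (Bruhat–Tits 1972 §10; Tits 1979 §2.4 ∕ §3.5; Serre, *Trees* II.1.1; Kottwitz 1986 §3)

Topic `NumberTheory/Automorphic`; namespace `Literature.NumberTheory.Automorphic.UnitaryLatticeTree`.  THEOREMS ONLY (no definition, no instance, no notation, no named fact,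
no `sorry`); kernel lane `--supports stmt-HodgeConjecture-24833`.  Cell `pub/hodgecm-mathlib` (D-0151), crux H413; road «S3-ram» (Literature seeding), organ A′ (ii) of the
P-1-ram skeleton (architect A-p16 (g31), ROAD-P1ram: (ii) = criterion ★ p847060 → THIS per-vertex child COUNT (a1) → shell sums (a2, F0P3a-p01 (g16)) → the closed forms
`X̃_j(N)` of CERT «P-1-ram profiles»).  DATUM-FREE (`K` with `Valued K ℤᵐ⁰`, `σ` valuation-preserving with `σϖ = −ϖ` and residually trivial — the tame-ramified tokens of ★ R3∕R6;
`J₀ = antidiag(1,1,1)`, `L₀ = 𝒪³`, `N₁ = latt diag(1,1,ϖ)`, `K₀ = U(σ,J₀) ∩ GL₃(𝒪)` = ★ `unitaryInt`; the lattice graph ★ `latticeGraph σ ϖ J₀` is the `(q+1)`-regular tree of ★ R6).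

THE MATHEMATICS.  In the tree a self-dual vertex `L₀` has `q + 1` modular (type-two) neighbours `κ·N₁` (`κ ∈ K₀`; ★ R2b), each with `q + 1` self-dual neighbours (★ R3): `L₀` itself
and the `q` CHILDREN THROUGH `κ·N₁`, `κ·(N₁ + 𝒪w(a,b))` with `|a| = 1` (`w(a,b) = (a∕ϖ, 0, b)`; `|a| < 1` gives back `L₀`, §1).  For `γ ∈ K₀` with `γ ≡ 1 (mod ϖ)` (depth
`d ≥ 1`; every modular neighbour is then fixed, ★ `mapGL_mapGL_N₁_eq_of_congr`) the fixed-child CRITERION ★ p847060 is INDEPENDENT of the child: through `κ·N₁` the `q`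
children are ALL fixed iff `|B₀(x, (γ − 1)x)| < |ϖ|`, `x = κe₀` (the «`d = 1`: `x̄ᵀ(J₀Ȳ)x̄ = 0`» of the certificates, `Ȳ = (γ − 1)∕ϖ mod ϖ`), else NONE.  Hence
**`#{children through κ·N₁ fixed by γ} = q·[|ϖ⁻¹B₀(x,(γ−1)x)| < 1]`** (§3–§4), `= q` for every `κ` when `γ ≡ 1 (mod ϖ²)` (§3), and ALL `q + 1` modular neighbours of `L₀` are
fixed (§5).  The number of modular neighbours `κ·N₁` passing the test is the number of ISOTROPIC points `x̄` of the residual conic with `x̄ᵀ(J₀Ȳ)x̄ = 0` — by the `O(J₀)`-type of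
the nilpotent `J₀`-symmetric `Ȳ`: all `q + 1` (`Ȳ = 0`), ONE (`Ȳ` of rank 1, either class) or TWO (`Ȳ` regular) — the finite-geometry half ★∕filed
`OrthogonalThreeIsotropicPointsNilpotentForm` (F0P3-p03 (g14)); with it: interior (`d ≥ 2`) vertices have all `q²` grandchildren fixed, regular depth-1 vertices `q` (one outward
line; the inward line always passes), rank-1 depth-1 vertices and boundary (`d = 0`) vertices are LEAVES of the fixed subtree (CERT smoke v1.3 §6 histograms, A-p16 (g31)).

* §1 `N₁_sup_span_vec_eq_stdLattice_of_v_lt_one` (`|a| < 1 = |b|` ⇒ `N₁ + 𝒪w(a,b) = L₀`), `N₁_lt_stdLattice_three`, `stdLattice_mem_neighborSet_N₁_of_neg`,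
  `exists_unit_vec_of_mem_neighborSet_N₁_of_ne_stdLattice` (a self-dual neighbour of `N₁` other than `L₀` is `N₁ + 𝒪w(a,b)` with `|a| = 1`).
* §2 `mapGL_eq_self_iff_of_mem_neighborSet_N₁_of_congr` — through `N₁`, every child is fixed iff `|ϖ⁻¹γ₂₀| < 1` (★ criterion, child-free).
* §3 **`ncard_fixed_children_N₁_of_congr`** — `#{w ∈ star(N₁) ∖ {L₀} : γ·w = w} = if |ϖ⁻¹γ₂₀| < 1 then q else 0`; `ncard_fixed_children_N₁_of_congr_sq` (`= q`).
* §4 **`ncard_fixed_children_of_congr`** — the same through ANY modular neighbour `κ·N₁` of `L₀`, test `|ϖ⁻¹B₀(x, (γ−1)x)| < 1`, `x = κe₀`; `…_of_congr_sq` (`= q`).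
* §5 `mapGL_eq_self_of_mem_neighborSet_root_of_congr`, **`ncard_fixed_neighborSet_root_of_congr`** (`= q + 1`: every modular neighbour of `L₀` is fixed).

HONEST LABEL: HC_CM is proved only modulo the 2 remaining named inputs (hLiu418 24832, h413 24833) until rung 0 closes; nothing printed is asserted here (elementary lattice
algebra over a valuation ring); «S3-ram» has no books consequence.

## References
* [BruhatTits1972] F. Bruhat, J. Tits, *Groupes réductifs sur un corps local I*, Publ. Math. IHÉS 41 (1972), §10 (lattice models; the star of a vertex = the residual building).
* [Tits1979] J. Tits, *Reductive groups over local fields*, PSPM 33.1 (1979), §2.4 (ramified `U(3)`: local index `(q+1, q+1)`), §3.5 (reduction mod `𝔭`).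
* [Serre1980Trees] J.-P. Serre, *Trees* (1980), Ch. II §1.1 (neighbours of a lattice = lines of its reduction; balls fixed by congruence subgroups).
* [Kottwitz1986] R. E. Kottwitz, *Base change for unit elements of Hecke algebras*, Compositio Math. 60 (1986), §3 (counting fixed lattices shell by shell).
-/

set_option autoImplicit false

noncomputable section

open scoped Valued WithZero Matrix MatrixGroups

namespace Literature.NumberTheory.Automorphic.UnitaryLatticeTree

open Literature.NumberTheory.Automorphic Literature.NumberTheory.Automorphic.HermitianLattice

variable {K : Type*} [Field K] [Valued K ℤᵐ⁰] {σ : K →+* K} {ϖ : K}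

/-! ## §1 The star of `N₁`: `L₀` and the `q` children `N₁ + 𝒪w(a,b)`, `|a| = 1` -/

/-- **`N₁ + 𝒪w(a,b) = L₀` when `|a| < 1`, `|b| = 1`**: `w(a,b) = (a∕ϖ, 0, b)` is then integral, and `e₂ = b⁻¹(w − (a∕ϖ)e₀)`. [cite: Serre1980Trees, II.1.1] [cite: BruhatTits1972, §10] -/
theorem N₁_sup_span_vec_eq_stdLattice_of_v_lt_one (hϖ : Valued.v ϖ = WithZero.exp (-1 : ℤ)) {a b : K} (ha : Valued.v a < 1) (hb : Valued.v b = 1) :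
    latt (Matrix.diagonal ![(1 : K), 1, ϖ]) ⊔ Submodule.span 𝒪[K] {(![a / ϖ, 0, b] : Fin 3 → K)} = stdLattice K 3 := by
  have hϖ0 : ϖ ≠ 0 := fun h0 => by rw [h0, map_zero] at hϖ; exact WithZero.coe_ne_zero hϖ.symm
  have hvϖ0 : Valued.v ϖ ≠ 0 := (Valuation.ne_zero_iff _).2 hϖ0
  have hϖ1 : Valued.v ϖ ≤ 1 := by rw [hϖ, ← WithZero.exp_zero]; exact WithZero.exp_le_exp.2 (by norm_num)
  have hlt : ∀ z : K, Valued.v z < 1 ↔ Valued.v z ≤ Valued.v ϖ := fun z => by rw [hϖ]; exact v_lt_one_iff z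
  have hd' : ∀ i, (![(1 : K), 1, ϖ] : Fin 3 → K) i ≠ 0 := by intro i; fin_cases i <;> simp [hϖ0]
  have hb0 : b ≠ 0 := fun h0 => by rw [h0, map_zero] at hb; exact zero_ne_one hb
  have haϖ : Valued.v (a / ϖ) ≤ 1 := by rw [map_div₀, div_le_one₀ (zero_lt_iff.2 hvϖ0)]; exact (hlt _).1 ha
  apply le_antisymm
  · refine sup_le (scaleLattice_stdLattice_le_N₁_le hϖ1 hϖ0).2 ((Submodule.span_singleton_le_iff_mem _ _).2 fun i => ?_)
    fin_cases i
    · simpa using haϖ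
    · simp
    · simpa using hb.le
  · rw [← latt_one]
    refine (latt_le_iff_forall_mulVec_single_mem _ _).2 fun j => ?_
    rw [Matrix.one_mulVec]
    fin_cases j
    · exact Submodule.mem_sup_left ((mem_latt_diagonal_iff hd' _).2 fun i => by fin_cases i <;> simp)
    · exact Submodule.mem_sup_left ((mem_latt_diagonal_iff hd' _).2 fun i => by fin_cases i <;> simp)
    · have hbinv : Valued.v b⁻¹ ≤ 1 := by rw [map_inv₀, hb, inv_one]
      have hmem : ((⟨b⁻¹, (Valuation.mem_integer_iff _ _).2 hbinv⟩ : 𝒪[K]) •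
          ((![a / ϖ, 0, b] : Fin 3 → K) - (⟨a / ϖ, (Valuation.mem_integer_iff _ _).2 haϖ⟩ : 𝒪[K]) • (![1, 0, 0] : Fin 3 → K))) ∈
          latt (Matrix.diagonal ![(1 : K), 1, ϖ]) ⊔ Submodule.span 𝒪[K] {(![a / ϖ, 0, b] : Fin 3 → K)} :=
        Submodule.smul_mem _ _ (Submodule.sub_mem _ (Submodule.mem_sup_right (Submodule.mem_span_singleton_self _))
          (Submodule.smul_mem _ _ (Submodule.mem_sup_left ((mem_latt_diagonal_iff hd' _).2 fun i => by fin_cases i <;> simp))))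
      have heq : ((⟨b⁻¹, (Valuation.mem_integer_iff _ _).2 hbinv⟩ : 𝒪[K]) •
          ((![a / ϖ, 0, b] : Fin 3 → K) - (⟨a / ϖ, (Valuation.mem_integer_iff _ _).2 haϖ⟩ : 𝒪[K]) • (![1, 0, 0] : Fin 3 → K)) : Fin 3 → K) =
          ![0, 0, 1] := by
        change b⁻¹ • ((![a / ϖ, 0, b] : Fin 3 → K) - (a / ϖ) • (![1, 0, 0] : Fin 3 → K)) = ![0, 0, 1]
        funext i; fin_cases i <;> simp [hb0]
      have hsingle : (Pi.single 2 1 : Fin 3 → K) = ![0, 0, 1] := by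
        funext i; fin_cases i <;> simp
      simp only [Fin.reduceFinMk]; rw [hsingle, ← heq]; exact hmem

/-- `N₁ < L₀`. [cite: Serre1980Trees, II.1.1] -/
theorem N₁_lt_stdLattice_three (hϖ : Valued.v ϖ = WithZero.exp (-1 : ℤ)) :
    latt (Matrix.diagonal ![(1 : K), 1, ϖ]) < stdLattice K 3 := by
  have hϖ1 : Valued.v ϖ < 1 := by rw [hϖ, ← WithZero.exp_zero]; exact WithZero.exp_lt_exp.2 (by norm_num)
  have h0 : Valued.v (0 : K) < 1 := by rw [map_zero]; exact zero_lt_one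
  have h := N₁_lt_N₁_sup_span_vec hϖ (a := 0) (b := 1) (Or.inr (map_one _))
  rwa [N₁_sup_span_vec_eq_stdLattice_of_v_lt_one hϖ h0 (map_one _)] at h

/-- `L₀` is a neighbour of `N₁` in the lattice graph. [cite: Serre1980Trees, II.1.1] -/
theorem stdLattice_mem_neighborSet_N₁_of_neg (hvσ : ∀ a, Valued.v (σ a) = Valued.v a) (hσϖ : σ ϖ = -ϖ) (hϖ : Valued.v ϖ = WithZero.exp (-1 : ℤ)) :
    (⟨stdLattice K 3, 0, isSelfDualLattice_stdLattice_three_of_v hϖ⟩ : {M : Submodule 𝒪[K] (Fin 3 → K) // IsVertex σ ϖ ((StdForm.antidiagonal 3).over K) M}) ∈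
      (latticeGraph σ ϖ ((StdForm.antidiagonal 3).over K)).neighborSet ⟨latt (Matrix.diagonal ![(1 : K), 1, ϖ]), 2, isVertexLattice_two_N₁_of_neg hσϖ hϖ⟩ :=
  (mem_neighborSet_N₁_iff_of_v hvσ hϖ (isVertexLattice_two_N₁_of_neg hσϖ hϖ) _).2 (N₁_lt_stdLattice_three hϖ)

/-- **A self-dual neighbour of `N₁` other than `L₀` is a CHILD `N₁ + 𝒪w(a,b)` with `|a| = 1`** (★ R3 exhaustion + §1). [cite: BruhatTits1972, §10] [cite: Serre1980Trees, II.1.1] -/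
theorem exists_unit_vec_of_mem_neighborSet_N₁_of_ne_stdLattice (hvσ : ∀ a, Valued.v (σ a) = Valued.v a) (hσϖ : σ ϖ = -ϖ) (hϖ : Valued.v ϖ = WithZero.exp (-1 : ℤ))
    (hres : ∀ x : K, Valued.v x ≤ 1 → Valued.v (σ x - x) < 1)
    {w : {M : Submodule 𝒪[K] (Fin 3 → K) // IsVertex σ ϖ ((StdForm.antidiagonal 3).over K) M}}
    (hw : w ∈ (latticeGraph σ ϖ ((StdForm.antidiagonal 3).over K)).neighborSet ⟨latt (Matrix.diagonal ![(1 : K), 1, ϖ]), 2, isVertexLattice_two_N₁_of_neg hσϖ hϖ⟩)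
    (hne : w.1 ≠ stdLattice K 3) :
    ∃ a b : K, Valued.v a = 1 ∧ Valued.v b ≤ 1 ∧ w.1 = latt (Matrix.diagonal ![(1 : K), 1, ϖ]) ⊔ Submodule.span 𝒪[K] {(![a / ϖ, 0, b] : Fin 3 → K)} := by
  obtain ⟨a, b, ha, hb, hprim, hw1⟩ := (mem_neighborSet_N₁_iff_exists_vec_of_neg hvσ hσϖ hϖ hres w).1 hw
  by_cases ha1 : Valued.v a = 1
  · exact ⟨a, b, ha1, hb, hw1⟩
  · exfalso
    exact hne (by rw [hw1]; exact N₁_sup_span_vec_eq_stdLattice_of_v_lt_one hϖ (lt_of_le_of_ne ha ha1) (hprim.resolve_left ha1))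

/-! ## §2 Through `N₁`, every child is fixed — or none -/

/-- **Child-free form of the criterion** (`γ ∈ K₀`, `γ ≡ 1 (mod ϖ)`): a self-dual neighbour `w ≠ L₀` of `N₁` is fixed by `γ` iff `|ϖ⁻¹γ₂₀| < 1` — the same test for all `q`
children (★ `mapGL_N₁_sup_span_vec_eq_iff_of_congr` + §1). [cite: Tits1979, §3.5] [cite: Serre1980Trees, II.1.1] -/
theorem mapGL_eq_self_iff_of_mem_neighborSet_N₁_of_congr (hvσ : ∀ a, Valued.v (σ a) = Valued.v a) (hσϖ : σ ϖ = -ϖ) (hϖ : Valued.v ϖ = WithZero.exp (-1 : ℤ))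
    (hres : ∀ x : K, Valued.v x ≤ 1 → Valued.v (σ x - x) < 1)
    {γ : unitaryGroupOfForm σ ((StdForm.antidiagonal 3).over K)} (hγK : γ ∈ unitaryInt σ ((StdForm.antidiagonal 3).over K))
    (hγϖ : ∀ i j, Valued.v ((((γ : GL (Fin 3) K) : Matrix (Fin 3) (Fin 3) K) - 1) i j) ≤ Valued.v ϖ)
    {w : {M : Submodule 𝒪[K] (Fin 3 → K) // IsVertex σ ϖ ((StdForm.antidiagonal 3).over K) M}}
    (hw : w ∈ (latticeGraph σ ϖ ((StdForm.antidiagonal 3).over K)).neighborSet ⟨latt (Matrix.diagonal ![(1 : K), 1, ϖ]), 2, isVertexLattice_two_N₁_of_neg hσϖ hϖ⟩)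
    (hne : w.1 ≠ stdLattice K 3) :
    mapGL (γ : GL (Fin 3) K) w.1 = w.1 ↔ Valued.v (ϖ⁻¹ * ((γ : GL (Fin 3) K) : Matrix (Fin 3) (Fin 3) K) 2 0) < 1 := by
  obtain ⟨a, b, ha, hb, hw1⟩ := exists_unit_vec_of_mem_neighborSet_N₁_of_ne_stdLattice hvσ hσϖ hϖ hres hw hne
  rw [hw1]
  exact mapGL_N₁_sup_span_vec_eq_iff_of_congr hvσ hϖ hγK hγϖ ha hb

/-! ## §3 The fixed-child count through `N₁` -/

/-- **THE FIXED-CHILD COUNT THROUGH `N₁`** (tamely ramified place, finite residue field `𝓀`, `q = |𝓀|`): for `γ ∈ K₀` with `γ ≡ 1 (mod ϖ)` the number of self-dual neighbours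
`w ≠ L₀` of `N₁` fixed by `γ` is `q` if `|ϖ⁻¹γ₂₀| < 1` and `0` otherwise (§2 and ★ R3 `#star(N₁) = q + 1`, `L₀ ∈ star(N₁)`). [cite: Tits1979, §2.4, §3.5] [cite: Serre1980Trees, II.1.1]
[cite: Kottwitz1986, §3] -/
theorem ncard_fixed_children_N₁_of_congr (hvσ : ∀ a, Valued.v (σ a) = Valued.v a) (hσϖ : σ ϖ = -ϖ) (hϖ : Valued.v ϖ = WithZero.exp (-1 : ℤ))
    (hres : ∀ x : K, Valued.v x ≤ 1 → Valued.v (σ x - x) < 1) [Finite 𝓀[K]]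
    {γ : unitaryGroupOfForm σ ((StdForm.antidiagonal 3).over K)} (hγK : γ ∈ unitaryInt σ ((StdForm.antidiagonal 3).over K))
    (hγϖ : ∀ i j, Valued.v ((((γ : GL (Fin 3) K) : Matrix (Fin 3) (Fin 3) K) - 1) i j) ≤ Valued.v ϖ) :
    {w | w ∈ (latticeGraph σ ϖ ((StdForm.antidiagonal 3).over K)).neighborSet ⟨latt (Matrix.diagonal ![(1 : K), 1, ϖ]), 2, isVertexLattice_two_N₁_of_neg hσϖ hϖ⟩ ∧
        w.1 ≠ stdLattice K 3 ∧ mapGL (γ : GL (Fin 3) K) w.1 = w.1}.ncard =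
      if Valued.v (ϖ⁻¹ * ((γ : GL (Fin 3) K) : Matrix (Fin 3) (Fin 3) K) 2 0) < 1 then Nat.card 𝓀[K] else 0 := by
  classical
  have hcard := ncard_neighborSet_N₁_of_neg hvσ hσϖ hϖ hres
  have hL₀ := stdLattice_mem_neighborSet_N₁_of_neg hvσ hσϖ hϖ (K := K)
  split_ifs with hc
  · -- every child is fixed: the set is `star(N₁) ∖ {L₀}`
    have hset : {w | w ∈ (latticeGraph σ ϖ ((StdForm.antidiagonal 3).over K)).neighborSet ⟨latt (Matrix.diagonal ![(1 : K), 1, ϖ]), 2, isVertexLattice_two_N₁_of_neg hσϖ hϖ⟩ ∧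
        w.1 ≠ stdLattice K 3 ∧ mapGL (γ : GL (Fin 3) K) w.1 = w.1} =
        (latticeGraph σ ϖ ((StdForm.antidiagonal 3).over K)).neighborSet ⟨latt (Matrix.diagonal ![(1 : K), 1, ϖ]), 2, isVertexLattice_two_N₁_of_neg hσϖ hϖ⟩ \
          {⟨stdLattice K 3, 0, isSelfDualLattice_stdLattice_three_of_v hϖ⟩} := by
      ext w
      simp only [Set.mem_setOf_eq, Set.mem_sdiff, Set.mem_singleton_iff]
      constructor
      · rintro ⟨hw, hne, -⟩
        exact ⟨hw, fun h => hne (by rw [h])⟩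
      · rintro ⟨hw, hne⟩
        have hne' : w.1 ≠ stdLattice K 3 := fun h => hne (Subtype.ext h)
        exact ⟨hw, hne', (mapGL_eq_self_iff_of_mem_neighborSet_N₁_of_congr hvσ hσϖ hϖ hres hγK hγϖ hw hne').2 hc⟩
    rw [hset, Set.ncard_sdiff_singleton_of_mem hL₀, hcard, Nat.add_sub_cancel]
  · -- no child is fixed
    have hset : {w | w ∈ (latticeGraph σ ϖ ((StdForm.antidiagonal 3).over K)).neighborSet ⟨latt (Matrix.diagonal ![(1 : K), 1, ϖ]), 2, isVertexLattice_two_N₁_of_neg hσϖ hϖ⟩ ∧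
        w.1 ≠ stdLattice K 3 ∧ mapGL (γ : GL (Fin 3) K) w.1 = w.1} = ∅ := by
      ext w
      simp only [Set.mem_setOf_eq, Set.mem_empty_iff_false, iff_false, not_and]
      intro hw hne hfix
      exact hc ((mapGL_eq_self_iff_of_mem_neighborSet_N₁_of_congr hvσ hσϖ hϖ hres hγK hγϖ hw hne).1 hfix)
    rw [hset, Set.ncard_empty]

/-- **A 2-deep element fixes all `q` children through `N₁`** (`γ ≡ 1 (mod ϖ²)`: the test `|ϖ⁻¹γ₂₀| ≤ |ϖ| < 1` passes). [cite: Tits1979, §3.5] [cite: Kottwitz1986, §3] -/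
theorem ncard_fixed_children_N₁_of_congr_sq (hvσ : ∀ a, Valued.v (σ a) = Valued.v a) (hσϖ : σ ϖ = -ϖ) (hϖ : Valued.v ϖ = WithZero.exp (-1 : ℤ))
    (hres : ∀ x : K, Valued.v x ≤ 1 → Valued.v (σ x - x) < 1) [Finite 𝓀[K]]
    {γ : unitaryGroupOfForm σ ((StdForm.antidiagonal 3).over K)} (hγK : γ ∈ unitaryInt σ ((StdForm.antidiagonal 3).over K))
    (hγϖ2 : ∀ i j, Valued.v ((((γ : GL (Fin 3) K) : Matrix (Fin 3) (Fin 3) K) - 1) i j) ≤ Valued.v ϖ ^ 2) :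
    {w | w ∈ (latticeGraph σ ϖ ((StdForm.antidiagonal 3).over K)).neighborSet ⟨latt (Matrix.diagonal ![(1 : K), 1, ϖ]), 2, isVertexLattice_two_N₁_of_neg hσϖ hϖ⟩ ∧
        w.1 ≠ stdLattice K 3 ∧ mapGL (γ : GL (Fin 3) K) w.1 = w.1}.ncard = Nat.card 𝓀[K] := by
  have hϖ0 : ϖ ≠ 0 := fun h0 => by rw [h0, map_zero] at hϖ; exact WithZero.coe_ne_zero hϖ.symm
  have hϖ1 : Valued.v ϖ < 1 := by rw [hϖ, ← WithZero.exp_zero]; exact WithZero.exp_lt_exp.2 (by norm_num)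
  have hϖle : Valued.v ϖ ≤ 1 := hϖ1.le
  have hγϖ : ∀ i j, Valued.v ((((γ : GL (Fin 3) K) : Matrix (Fin 3) (Fin 3) K) - 1) i j) ≤ Valued.v ϖ := fun i j =>
    (hγϖ2 i j).trans (by rw [sq]; exact mul_le_of_le_one_left zero_le hϖle)
  have hc : Valued.v (ϖ⁻¹ * ((γ : GL (Fin 3) K) : Matrix (Fin 3) (Fin 3) K) 2 0) < 1 := by
    have h20 : Valued.v (((γ : GL (Fin 3) K) : Matrix (Fin 3) (Fin 3) K) 2 0) ≤ Valued.v ϖ ^ 2 := by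
      have h := hγϖ2 2 0
      rwa [Matrix.sub_apply, Matrix.one_apply_ne (by decide), sub_zero] at h
    rw [map_mul, map_inv₀]
    calc (Valued.v ϖ)⁻¹ * Valued.v (((γ : GL (Fin 3) K) : Matrix (Fin 3) (Fin 3) K) 2 0) ≤ (Valued.v ϖ)⁻¹ * Valued.v ϖ ^ 2 := mul_le_mul' le_rfl h20
      _ = Valued.v ϖ := by rw [sq, ← mul_assoc, inv_mul_cancel₀ ((Valuation.ne_zero_iff _).2 hϖ0), one_mul]
      _ < 1 := hϖ1
  rw [ncard_fixed_children_N₁_of_congr hvσ hσϖ hϖ hres hγK hγϖ, if_pos hc]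

/-! ## §4 The fixed-child count through any modular neighbour `κ·N₁` of `L₀` -/

/-- **THE FIXED-CHILD COUNT THROUGH `κ·N₁`** (`κ ∈ K₀`, `x = κe₀` its isotropic vector; `γ ∈ K₀`, `γ ≡ 1 (mod ϖ)`): the number of self-dual neighbours `w ≠ L₀` of `κ·N₁` fixed
by `γ` is `q` if `|ϖ⁻¹·B₀(x, (γ − 1)x)| < 1` and `0` otherwise — transport of §3 along the graph automorphism `κ` (★ `latticeGraphIso`), the test read through ★
`coe_inv_mul_mul_sub_one` ∕ ★ `inv_mul_mul_apply_two_zero_eq_B₀`. [cite: Tits1979, §2.4, §3.5] [cite: BruhatTits1972, §10] [cite: Kottwitz1986, §3] -/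
theorem ncard_fixed_children_of_congr (hvσ : ∀ a, Valued.v (σ a) = Valued.v a) (hσϖ : σ ϖ = -ϖ) (hϖ : Valued.v ϖ = WithZero.exp (-1 : ℤ))
    (hres : ∀ x : K, Valued.v x ≤ 1 → Valued.v (σ x - x) < 1) [Finite 𝓀[K]]
    {γ κ : unitaryGroupOfForm σ ((StdForm.antidiagonal 3).over K)} (hγK : γ ∈ unitaryInt σ ((StdForm.antidiagonal 3).over K)) (hκK : κ ∈ unitaryInt σ ((StdForm.antidiagonal 3).over K))
    (hγϖ : ∀ i j, Valued.v ((((γ : GL (Fin 3) K) : Matrix (Fin 3) (Fin 3) K) - 1) i j) ≤ Valued.v ϖ) :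
    {w | w ∈ (latticeGraph σ ϖ ((StdForm.antidiagonal 3).over K)).neighborSet
          (latticeGraphIso σ ϖ ((StdForm.antidiagonal 3).over K) κ ⟨latt (Matrix.diagonal ![(1 : K), 1, ϖ]), 2, isVertexLattice_two_N₁_of_neg hσϖ hϖ⟩) ∧
        w.1 ≠ stdLattice K 3 ∧ mapGL (γ : GL (Fin 3) K) w.1 = w.1}.ncard =
      if Valued.v (ϖ⁻¹ * B₀ σ 3 (fun i => ((κ : GL (Fin 3) K) : Matrix (Fin 3) (Fin 3) K) i 0)
          ((((γ : GL (Fin 3) K) : Matrix (Fin 3) (Fin 3) K) - 1).mulVec (fun i => ((κ : GL (Fin 3) K) : Matrix (Fin 3) (Fin 3) K) i 0))) < 1 then Nat.card 𝓀[K] else 0 := by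
  classical
  -- the conjugate `γ′ = κ⁻¹γκ ∈ K₀`, `γ′ ≡ 1 (mod ϖ)`, `γ′₂₀ = B₀(x, (γ−1)x)`
  have hγ'K : κ⁻¹ * γ * κ ∈ unitaryInt σ ((StdForm.antidiagonal 3).over K) := Subgroup.mul_mem _ (Subgroup.mul_mem _ (Subgroup.inv_mem _ hκK) hγK) hκK
  have hγ'ϖ : ∀ i j, Valued.v (((((κ⁻¹ * γ * κ : unitaryGroupOfForm σ ((StdForm.antidiagonal 3).over K)) : GL (Fin 3) K) : Matrix (Fin 3) (Fin 3) K) - 1) i j) ≤ Valued.v ϖ :=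
    v_inv_mul_mul_sub_one_apply_le hκK hγϖ
  have h20 : (((κ⁻¹ * γ * κ : unitaryGroupOfForm σ ((StdForm.antidiagonal 3).over K)) : GL (Fin 3) K) : Matrix (Fin 3) (Fin 3) K) 2 0 =
      B₀ σ 3 (fun i => ((κ : GL (Fin 3) K) : Matrix (Fin 3) (Fin 3) K) i 0) ((((γ : GL (Fin 3) K) : Matrix (Fin 3) (Fin 3) K) - 1).mulVec (fun i => ((κ : GL (Fin 3) K) : Matrix (Fin 3) (Fin 3) K) i 0)) := by
    have h := congrFun (congrFun (coe_inv_mul_mul_sub_one γ κ) 2) 0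
    rw [Matrix.sub_apply, Matrix.one_apply_ne (by decide), sub_zero] at h
    rw [h, inv_mul_mul_apply_two_zero_eq_B₀]
  -- transport of the set along `κ`
  set e := latticeGraphIso σ ϖ ((StdForm.antidiagonal 3).over K) κ with he
  have himage : {w | w ∈ (latticeGraph σ ϖ ((StdForm.antidiagonal 3).over K)).neighborSet
          (e ⟨latt (Matrix.diagonal ![(1 : K), 1, ϖ]), 2, isVertexLattice_two_N₁_of_neg hσϖ hϖ⟩) ∧ w.1 ≠ stdLattice K 3 ∧ mapGL (γ : GL (Fin 3) K) w.1 = w.1} =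
      e '' {w | w ∈ (latticeGraph σ ϖ ((StdForm.antidiagonal 3).over K)).neighborSet ⟨latt (Matrix.diagonal ![(1 : K), 1, ϖ]), 2, isVertexLattice_two_N₁_of_neg hσϖ hϖ⟩ ∧
        w.1 ≠ stdLattice K 3 ∧ mapGL ((κ⁻¹ * γ * κ : unitaryGroupOfForm σ ((StdForm.antidiagonal 3).over K)) : GL (Fin 3) K) w.1 = w.1} := by
    ext w
    simp only [Set.mem_setOf_eq, Set.mem_image]
    constructor
    · rintro ⟨hw, hne, hfix⟩
      refine ⟨e.symm w, ⟨?_, ?_, ?_⟩, e.apply_symm_apply w⟩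
      · rw [SimpleGraph.mem_neighborSet] at hw ⊢
        have h' : (latticeGraph σ ϖ ((StdForm.antidiagonal 3).over K)).Adj (e ⟨latt (Matrix.diagonal ![(1 : K), 1, ϖ]), 2, isVertexLattice_two_N₁_of_neg hσϖ hϖ⟩) (e (e.symm w)) := by
          rw [e.apply_symm_apply]; exact hw
        exact e.map_adj_iff.1 h'
      · intro h
        apply hne
        have h1 : w.1 = mapGL (κ : GL (Fin 3) K) (e.symm w).1 := by
          conv_lhs => rw [← e.apply_symm_apply w]
          rfl
        rw [h1, h, mapGL_stdLattice_of_mem_unitaryInt hκK]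
      · have h1 : w.1 = mapGL (κ : GL (Fin 3) K) (e.symm w).1 := by
          conv_lhs => rw [← e.apply_symm_apply w]
          rfl
        rw [h1] at hfix
        have h2 := (mapGL_mapGL_eq_iff_mapGL_conj_eq (γ : GL (Fin 3) K) (κ : GL (Fin 3) K) (e.symm w).1).1 hfix
        simpa only [Subgroup.coe_mul, Subgroup.coe_inv] using h2
    · rintro ⟨u, ⟨hu, hne, hfix⟩, rfl⟩
      refine ⟨by rw [SimpleGraph.mem_neighborSet] at hu ⊢; exact e.map_adj_iff.2 hu, ?_, ?_⟩
      · intro h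
        apply hne
        have h1 : (e u).1 = mapGL (κ : GL (Fin 3) K) u.1 := rfl
        rw [h1] at h
        have h2 := congrArg (mapGL ((κ : GL (Fin 3) K)⁻¹)) h
        rwa [← mapGL_mul, inv_mul_cancel, mapGL_one, ← Subgroup.coe_inv, mapGL_stdLattice_of_mem_unitaryInt (Subgroup.inv_mem _ hκK)] at h2
      · have h1 : (e u).1 = mapGL (κ : GL (Fin 3) K) u.1 := rfl
        rw [h1]
        refine (mapGL_mapGL_eq_iff_mapGL_conj_eq (γ : GL (Fin 3) K) (κ : GL (Fin 3) K) u.1).2 ?_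
        simpa only [Subgroup.coe_mul, Subgroup.coe_inv] using hfix
  rw [himage, Set.ncard_image_of_injective _ e.injective, ncard_fixed_children_N₁_of_congr hvσ hσϖ hϖ hres hγ'K hγ'ϖ, h20]

/-- **A 2-deep element fixes all `q` children through every modular neighbour `κ·N₁`.** [cite: Tits1979, §3.5] [cite: Kottwitz1986, §3] -/
theorem ncard_fixed_children_of_congr_sq (hvσ : ∀ a, Valued.v (σ a) = Valued.v a) (hσϖ : σ ϖ = -ϖ) (hϖ : Valued.v ϖ = WithZero.exp (-1 : ℤ))
    (hres : ∀ x : K, Valued.v x ≤ 1 → Valued.v (σ x - x) < 1) [Finite 𝓀[K]]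
    {γ κ : unitaryGroupOfForm σ ((StdForm.antidiagonal 3).over K)} (hγK : γ ∈ unitaryInt σ ((StdForm.antidiagonal 3).over K)) (hκK : κ ∈ unitaryInt σ ((StdForm.antidiagonal 3).over K))
    (hγϖ2 : ∀ i j, Valued.v ((((γ : GL (Fin 3) K) : Matrix (Fin 3) (Fin 3) K) - 1) i j) ≤ Valued.v ϖ ^ 2) :
    {w | w ∈ (latticeGraph σ ϖ ((StdForm.antidiagonal 3).over K)).neighborSet
          (latticeGraphIso σ ϖ ((StdForm.antidiagonal 3).over K) κ ⟨latt (Matrix.diagonal ![(1 : K), 1, ϖ]), 2, isVertexLattice_two_N₁_of_neg hσϖ hϖ⟩) ∧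
        w.1 ≠ stdLattice K 3 ∧ mapGL (γ : GL (Fin 3) K) w.1 = w.1}.ncard = Nat.card 𝓀[K] := by
  classical
  have hϖ0 : ϖ ≠ 0 := fun h0 => by rw [h0, map_zero] at hϖ; exact WithZero.coe_ne_zero hϖ.symm
  have hϖ1 : Valued.v ϖ < 1 := by rw [hϖ, ← WithZero.exp_zero]; exact WithZero.exp_lt_exp.2 (by norm_num)
  have hγϖ : ∀ i j, Valued.v ((((γ : GL (Fin 3) K) : Matrix (Fin 3) (Fin 3) K) - 1) i j) ≤ Valued.v ϖ := fun i j =>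
    (hγϖ2 i j).trans (by rw [sq]; exact mul_le_of_le_one_left zero_le hϖ1.le)
  -- the conjugate is 2-deep as well, so its corner test passes
  have hγ'ϖ2 : ∀ i j, Valued.v (((((κ⁻¹ * γ * κ : unitaryGroupOfForm σ ((StdForm.antidiagonal 3).over K)) : GL (Fin 3) K) : Matrix (Fin 3) (Fin 3) K) - 1) i j) ≤ Valued.v (ϖ ^ 2) := by
    have h : ∀ i j, Valued.v ((((γ : GL (Fin 3) K) : Matrix (Fin 3) (Fin 3) K) - 1) i j) ≤ Valued.v (ϖ ^ 2) := fun i j => by rw [map_pow]; exact hγϖ2 i j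
    exact v_inv_mul_mul_sub_one_apply_le (ϖ := ϖ ^ 2) hκK h
  have h20 : Valued.v (B₀ σ 3 (fun i => ((κ : GL (Fin 3) K) : Matrix (Fin 3) (Fin 3) K) i 0)
      ((((γ : GL (Fin 3) K) : Matrix (Fin 3) (Fin 3) K) - 1).mulVec (fun i => ((κ : GL (Fin 3) K) : Matrix (Fin 3) (Fin 3) K) i 0))) ≤ Valued.v ϖ ^ 2 := by
    have h := hγ'ϖ2 2 0
    have e1 := congrFun (congrFun (coe_inv_mul_mul_sub_one γ κ) 2) 0
    rw [e1, inv_mul_mul_apply_two_zero_eq_B₀, map_pow] at h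
    exact h
  have hc : Valued.v (ϖ⁻¹ * B₀ σ 3 (fun i => ((κ : GL (Fin 3) K) : Matrix (Fin 3) (Fin 3) K) i 0)
      ((((γ : GL (Fin 3) K) : Matrix (Fin 3) (Fin 3) K) - 1).mulVec (fun i => ((κ : GL (Fin 3) K) : Matrix (Fin 3) (Fin 3) K) i 0))) < 1 := by
    rw [map_mul, map_inv₀]
    calc (Valued.v ϖ)⁻¹ * Valued.v (B₀ σ 3 (fun i => ((κ : GL (Fin 3) K) : Matrix (Fin 3) (Fin 3) K) i 0)
          ((((γ : GL (Fin 3) K) : Matrix (Fin 3) (Fin 3) K) - 1).mulVec (fun i => ((κ : GL (Fin 3) K) : Matrix (Fin 3) (Fin 3) K) i 0))) ≤ (Valued.v ϖ)⁻¹ * Valued.v ϖ ^ 2 :=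
          mul_le_mul' le_rfl h20
      _ = Valued.v ϖ := by rw [sq, ← mul_assoc, inv_mul_cancel₀ ((Valuation.ne_zero_iff _).2 hϖ0), one_mul]
      _ < 1 := hϖ1
  rw [ncard_fixed_children_of_congr hvσ hσϖ hϖ hres hγK hκK hγϖ, if_pos hc]

/-! ## §5 The star of `L₀`: a deep element fixes every modular neighbour -/

/-- **`γ ≡ 1 (mod ϖ)` fixes every modular neighbour of `L₀`** (each is `κ·N₁`, `κ ∈ K₀` — ★ root-star transitivity — and ★ `mapGL_mul_N₁_eq_of_congr_one`). `|2| = 1` supplies the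
trace element `½`. [cite: Tits1979, §3.5] [cite: Serre1980Trees, II.1.1] -/
theorem mapGL_eq_self_of_mem_neighborSet_root_of_congr (hσ : ∀ x, σ (σ x) = x) (hvσ : ∀ a, Valued.v (σ a) = Valued.v a) (hσϖ : σ ϖ = -ϖ)
    (hϖ : Valued.v ϖ = WithZero.exp (-1 : ℤ)) (h2 : Valued.v (2 : K) = 1)
    {γ : unitaryGroupOfForm σ ((StdForm.antidiagonal 3).over K)} (hγK : γ ∈ unitaryInt σ ((StdForm.antidiagonal 3).over K))
    (hγ1 : ∀ i j, Valued.v ((((γ : GL (Fin 3) K) : Matrix (Fin 3) (Fin 3) K) - 1) i j) < 1)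
    {w : {M : Submodule 𝒪[K] (Fin 3 → K) // IsVertex σ ϖ ((StdForm.antidiagonal 3).over K) M}}
    (hw : w ∈ (latticeGraph σ ϖ ((StdForm.antidiagonal 3).over K)).neighborSet ⟨stdLattice K 3, 0, isSelfDualLattice_stdLattice_three_of_v hϖ⟩) :
    mapGL (γ : GL (Fin 3) K) w.1 = w.1 := by
  have h20 : (2 : K) ≠ 0 := fun h => by rw [h, map_zero] at h2; exact zero_ne_one h2
  have htrace : ∃ t : K, Valued.v t ≤ 1 ∧ t + σ t = 1 :=
    ⟨2⁻¹, by rw [map_inv₀, h2, inv_one], by rw [map_inv₀, map_ofNat]; field_simp; norm_num⟩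
  obtain ⟨κ, hκK, hw1⟩ := (mem_neighborSet_root_iff_exists_mem_unitaryInt_of_trace hσ hvσ hϖ htrace (isVertexLattice_two_N₁_of_neg hσϖ hϖ) w).1 hw
  rw [hw1]
  exact mapGL_mul_N₁_eq_of_congr_one hvσ hϖ hγK hκK hγ1

/-- **THE FIXED STAR OF `L₀` FOR A DEEP ELEMENT has all `q + 1` modular neighbours** (★ R2b `#star(L₀) = q + 1`). [cite: Tits1979, §2.4, §3.5] [cite: Serre1980Trees, II.1.1] -/
theorem ncard_fixed_neighborSet_root_of_congr (hσ : ∀ x, σ (σ x) = x) (hvσ : ∀ a, Valued.v (σ a) = Valued.v a) (hσϖ : σ ϖ = -ϖ)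
    (hϖ : Valued.v ϖ = WithZero.exp (-1 : ℤ)) (hres : ∀ x : K, Valued.v x ≤ 1 → Valued.v (σ x - x) < 1) (h2 : Valued.v (2 : K) = 1) [Finite 𝓀[K]]
    {γ : unitaryGroupOfForm σ ((StdForm.antidiagonal 3).over K)} (hγK : γ ∈ unitaryInt σ ((StdForm.antidiagonal 3).over K))
    (hγ1 : ∀ i j, Valued.v ((((γ : GL (Fin 3) K) : Matrix (Fin 3) (Fin 3) K) - 1) i j) < 1) :
    {w | w ∈ (latticeGraph σ ϖ ((StdForm.antidiagonal 3).over K)).neighborSet ⟨stdLattice K 3, 0, isSelfDualLattice_stdLattice_three_of_v hϖ⟩ ∧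
        mapGL (γ : GL (Fin 3) K) w.1 = w.1}.ncard = Nat.card 𝓀[K] + 1 := by
  have hset : {w | w ∈ (latticeGraph σ ϖ ((StdForm.antidiagonal 3).over K)).neighborSet ⟨stdLattice K 3, 0, isSelfDualLattice_stdLattice_three_of_v hϖ⟩ ∧
        mapGL (γ : GL (Fin 3) K) w.1 = w.1} = (latticeGraph σ ϖ ((StdForm.antidiagonal 3).over K)).neighborSet ⟨stdLattice K 3, 0, isSelfDualLattice_stdLattice_three_of_v hϖ⟩ := by
    ext w
    simp only [Set.mem_setOf_eq]
    exact ⟨fun h => h.1, fun h => ⟨h, mapGL_eq_self_of_mem_neighborSet_root_of_congr hσ hvσ hσϖ hϖ h2 hγK hγ1 h⟩⟩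
  rw [hset]
  exact ncard_neighborSet_root_of_ramified hσ hvσ hϖ hres h2 (isVertexLattice_two_N₁_of_neg hσϖ hϖ)

end Literature.NumberTheory.Automorphic.UnitaryLatticeTree

end
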